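import Literature.IUT.HodgeArakelov.FlTorsorStructureConjGenuine
import Literature.AnabelianGeometry.SemiGraphs.TemperedCompletionExistence
import Literature.AnabelianGeometry.Anabelioids.Basic
import HarnessLib

/-!
# [IUTchII] Def 2.3 (v) at the genuine tower: the cusp-SEPARATION binder transported to the curve's OWN profinite completion `Π_{X_K}`
# — the residual of «`|LabCusp^±(Π̂^±_v)| = l`» / `FlTorsorStructureConj` in the currency of [GalSect] Thm 1.3 (ii) / [AbsTopI] Lem 4.5 (vi)

S. Mochizuki, *Inter-universal Teichmüller theory II*, kurims manuscript (Dec. 2020), §2 Def 2.3 (ii) p. 68 («the cuspidal inertia groups …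
may be reconstructed group-theoretically … [AbsTopI], Lemma 4.5»), (v) p. 69 [claim: Mochizuki2012, status: disputed] (IUTchII §2 Def 2.3
(v), kurims p.69) (D-0012 claim key; record-only).  Inputs in print: [AbsTopI] Lem 4.5 (vi) p. 55 («Let `I ⊆ Π` be a decomposition group of a
cusp. Then `I = C_Π(I ∩ Δ)`») [cite: MochizukiAbsTopI2012, Lemma 4.5 (vi) p.55]; S. Mochizuki, *Galois sections in absolute anabelian geometry*
[GalSect] = [Mzk8], Thm 1.3 (ii) p. 6 («`D_x` is commensurably terminal … if `x` is a cusp, then `D_x = C_{Π_{X_K}}(H)` for any open subgroup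
`H ⊆ I_x`») [cite: MochizukiGalSect2005, Thm 1.3 (ii) p.6]; [SemiAnbd] §6 p. 69 («`∧` denotes profinite completion, or, equivalently, closure in
`Π_{X_K}`») [cite: MochizukiSemiAnbd2006, §6 p.69].

abc-iut cell, seat abc-iut-w5-d132 (gen 6), row «DEF23V-SEP-CURRENCY» (sequel to p449023 / p450102).  PROOF-ONLY (no `def`, no instance, no new
named fact).  The ONE profinite binder of `card_labCuspPM_ofPiCHat_eq_l` / `nonempty_flTorsorStructureConj_ofPiCHat` was stated in the ambient
`Q = Π̂_C` («`N(ι inclX I_{x₀}) ∩ cl ι(inclX Π^tp_X) ≤ ι inclX D_{x₀}`»).  Here it is DERIVED from the same statement phrased on the curve's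
OWN profinite completion `toHat : Π^tp_X → Π_{X_K} = M.PiHat` ([SemiAnbd] §6 interface) — the currency in which abc-iut-f-174's
`TemperedDecompositionOfProfinite` consumes [Mzk8] Thm 1.3 (ii) (binder `h13ii′`, FACT-LIST F-0103 `GalSect.Thm_1_3_ii_cusps` / F-0207
`CuspidalData.DecompEqCommensuratorOfInertia` / F-0405 `DecompEqNormalizer`, instance forms):

* `exists_continuousMulEquiv_range_inclX` — `Π^tp_X ≃ₜ* inclX(Π^tp_X)` (abc-iut-L2-d3's `CLevelData`: `inclX` is an open embedding);
* `exists_hat_comparison` — **uniqueness of profinite completions**: an injective `ψ : Π_{X_K} →* Q` with `ψ ∘ toHat = ι ∘ inclX` and image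
  `cl ι(inclX Π^tp_X)` (abc-iut-L2-d1 `exists_restrict_of_isOpen_of_finiteIndex` «closure = completion» for the open index-`2` subgroup
  `inclX(Π^tp_X) ≤ Π^tp_C`, `comp_continuousMulEquiv_source`, `nonempty_continuousMulEquiv`);
* **`normalizer_inf_closure_le_of_hat`** — TRANSPORT: «`N_{Π_{X_K}}(toHat I_{x₀}) ≤ toHat D_{x₀}`» ([AbsTopIII] Thm 1.11 (b) / [AbsTopI] Lem 4.5 (vi)
  `⊇` at the curve's completion) ⟹ the `Q`-level binder `h45vi` of p449023/p450102;
* `normalizer_map_toHat_inertia_le_of_h13ii` — abc-iut-f-174's VERBATIM binder `h13ii′` ([GalSect] Thm 1.3 (ii) for cusps on `M.PiHat`) ⟹ the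
  normaliser form (normaliser ≤ commensurator, `toHat I_{x₀}` closed of finite index `1` in `toHat D_{x₀} ∩ Ker augHat = toHat I_{x₀}`);
* **`card_labCuspPM_ofPiCHat_eq_l_of_h13ii`**, **`nonempty_flTorsorStructureConj_ofPiCHat_of_h13ii`** — the row's results with the separation
  residual in f-174's currency: `|LabCusp^±(Π̂^±_v)| = l` and `Nonempty (FlTorsorStructureConj CuHat)` at the tower of record modulo
  {`h13ii′` = [GalSect] Thm 1.3 (ii) (F-0103) at `Π_{X_K}`, (R1c) `hR1c` (for the torsor structure only), F-1674, `op`, «unique cusp», L02 `hZ`, `hN`}.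

HONEST LABEL: transport lemmas in classical profinite group theory + the [SemiAnbd] §6 interface; the named binders are printed inputs
carried as hypotheses, never asserted; nothing of the series is asserted; no side taken on [IUTchIII] Cor 3.12; typed ≠ proved.
-/

noncomputable section

namespace Literature.IUT.HodgeArakelov

open Literature.AnabelianGeometry Literature.AnabelianGeometry.EtaleTheta Literature.AnabelianGeometry.SemiGraphs
open scoped Pointwise

/-- Pushing a conjugate forward: `f(a H a⁻¹) = f(a) f(H) f(a)⁻¹`. [folklore] -/
private theorem map_conj_smul' {A B : Type*} [Group A] [Group B] (f : A →* B) (a : A) (H : Subgroup A) :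
    (MulAut.conj a • H).map f = MulAut.conj (f a) • H.map f := by
  rw [conj_smul_eq_map_conj, conj_smul_eq_map_conj, Subgroup.map_map, Subgroup.map_map]
  congr 1
  ext x
  simp [MulAut.conj_apply]

namespace PlusMinusTower

variable {p : ℕ} [Fact p.Prime] {M : MuTwoSetting p} (e : M.CLevelData)
  {Q : Type} [Group Q] [TopologicalSpace Q] [IsTopologicalGroup Q]
  (ι : M.GtpC →ₜ* Q) (hι : IsProfiniteCompletion ι)

/-! ## 1. The comparison `Π_{X_K} ≅ cl ι(inclX Π^tp_X) ⊆ Q` (uniqueness of profinite completions) -/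

section Comparison

include e in
/-- `Π^tp_X ≃ inclX(Π^tp_X)` as TOPOLOGICAL groups (`inclX` is an open embedding: abc-iut-L2-d3's `continuous_ofInjective_symm`); existence form.
[cite: MochizukiEtTh2009, Def 1.7 p.27] -/
theorem exists_continuousMulEquiv_range_inclX :
    ∃ κ : M.PiTemp ≃ₜ* ↥M.inclX.range, ∀ y, ((κ y : M.inclX.range) : M.GtpC) = M.inclX y := by
  let κ₀ : M.PiTemp ≃* ↥M.inclX.range := MonoidHom.ofInjective M.injective_inclX
  have hcont : Continuous κ₀ := M.continuous_inclX.subtype_mk _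
  have hcont' : Continuous κ₀.symm := e.continuous_ofInjective_symm
  exact ⟨{ κ₀ with continuous_toFun := hcont, continuous_invFun := hcont' }, fun _ => rfl⟩

include e hι in
/-- **Uniqueness of profinite completions**: the curve's own completion `toHat : Π^tp_X → Π_{X_K}` and the closure `cl ι(inclX Π^tp_X)` of
`Π^tp_X` inside ANY injective profinite completion `ι : Π^tp_C → Q` are canonically isomorphic — there is an injective `ψ : Π_{X_K} →* Q` with
`ψ ∘ toHat = ι ∘ inclX` and `ψ(Π_{X_K}) = cl ι(inclX Π^tp_X)` («closure = completion», [SemiAnbd] §6 p. 69). [cite: MochizukiSemiAnbd2006, §6 p.69] -/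
theorem exists_hat_comparison :
    ∃ ψ : M.PiHat →* Q, Function.Injective ψ ∧ (∀ g, ψ (M.toHat g) = ι (M.inclX g)) ∧
      ψ.range = (M.inclX.range.map ι.toMonoidHom : Subgroup Q).topologicalClosure := by
  haveI : M.inclX.range.FiniteIndex := ⟨by rw [M.index_range_inclX]; exact two_ne_zero⟩
  obtain ⟨ιU, hιU, hιUc⟩ := hι.exists_restrict_of_isOpen_of_finiteIndex M.inclX.range M.isOpen_range_inclX
  obtain ⟨κ, hκ⟩ := exists_continuousMulEquiv_range_inclX e
  let ι' : M.PiTemp →ₜ* ↥((M.inclX.range.map ι.toMonoidHom : Subgroup Q).topologicalClosure) :=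
    ιU.comp ⟨κ.toMulEquiv.toMonoidHom, κ.continuous⟩
  have hι'c : IsProfiniteCompletion ι' := IsProfiniteCompletion.comp_continuousMulEquiv_source hιUc κ ι' fun _ => rfl
  have hι' : ∀ g, ((ι' g : (M.inclX.range.map ι.toMonoidHom : Subgroup Q).topologicalClosure) : Q) = ι (M.inclX g) := by
    intro g
    change ((ιU (κ g) : (M.inclX.range.map ι.toMonoidHom : Subgroup Q).topologicalClosure) : Q) = _
    rw [hιU, hκ]
  obtain ⟨θ, hθ⟩ := IsProfiniteCompletion.nonempty_continuousMulEquiv M.isProfiniteCompletion_toHat hι'c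
  refine ⟨(Subgroup.subtype _).comp θ.toMulEquiv.toMonoidHom, Subtype.val_injective.comp θ.injective, fun g => ?_, ?_⟩
  · change ((θ (M.toHat g) : (M.inclX.range.map ι.toMonoidHom : Subgroup Q).topologicalClosure) : Q) = _
    rw [hθ, hι']
  · ext q
    constructor
    · rintro ⟨x, rfl⟩
      exact (θ x).2
    · intro hq
      refine ⟨θ.symm ⟨q, hq⟩, ?_⟩
      change ((θ.toMulEquiv (θ.toMulEquiv.symm ⟨q, hq⟩) : (M.inclX.range.map ι.toMonoidHom : Subgroup Q).topologicalClosure) : Q) = q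
      rw [MulEquiv.apply_symm_apply]

end Comparison

/-! ## 2. Transport of the separation binder from `Π_{X_K}` to `Q` -/

section Transport

variable {x₀ : M.Pt}

include e hι in
/-- **TRANSPORT of cusp separation**: if the normaliser in the curve's OWN profinite completion `Π_{X_K}` of the cuspidal inertia group
`toHat(I_{x₀})` lies in the decomposition group `toHat(D_{x₀})` ([AbsTopIII] Thm 1.11 (b) / [AbsTopI] Lem 4.5 (vi) `⊇` / [GalSect] Thm 1.3 (ii) at
`Π_{X_K}`), then the same holds for `Π̂_X = cl ι(inclX Π^tp_X)` inside ANY injective profinite completion `Q` of `Π^tp_C`: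
`N_Q(ι inclX I_{x₀}) ∩ Π̂_X ≤ ι inclX D_{x₀}` — the binder `h45vi` of p449023 / p450102. [cite: MochizukiAbsTopI2012, Lemma 4.5 (vi) p.55] -/
theorem normalizer_inf_closure_le_of_hat
    (h111 : Subgroup.normalizer (((M.toTemperedCurve.inertia x₀).map M.toHat.toMonoidHom : Subgroup M.PiHat) : Set M.PiHat) ≤
      (M.decomp x₀).map M.toHat.toMonoidHom) :
    Subgroup.normalizer ((((M.toTemperedCurve.inertia x₀).map M.inclX).map ι.toMonoidHom : Subgroup Q) : Set Q) ⊓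
        (M.inclX.range.map ι.toMonoidHom).topologicalClosure ≤ ((M.decomp x₀).map M.inclX).map ι.toMonoidHom := by
  obtain ⟨ψ, hψinj, hψ, hrange⟩ := exists_hat_comparison e ι hι
  have hcomp : ψ.comp M.toHat.toMonoidHom = ι.toMonoidHom.comp M.inclX := MonoidHom.ext hψ
  have hmapI : (((M.toTemperedCurve.inertia x₀).map M.inclX).map ι.toMonoidHom : Subgroup Q) =
      ((M.toTemperedCurve.inertia x₀).map M.toHat.toMonoidHom).map ψ := by
    rw [Subgroup.map_map, Subgroup.map_map, hcomp]
  have hmapD : (((M.decomp x₀).map M.inclX).map ι.toMonoidHom : Subgroup Q) = ((M.decomp x₀).map M.toHat.toMonoidHom).map ψ := by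
    rw [Subgroup.map_map, Subgroup.map_map, hcomp]
  intro q hq
  obtain ⟨hqN, hqX⟩ := Subgroup.mem_inf.mp hq
  rw [← hrange] at hqX
  obtain ⟨y, rfl⟩ := hqX
  rw [mem_normalizer_iff_conj_smul_eq, hmapI, ← map_conj_smul'] at hqN
  have hy : MulAut.conj y • (M.toTemperedCurve.inertia x₀).map M.toHat.toMonoidHom =
      (M.toTemperedCurve.inertia x₀).map M.toHat.toMonoidHom := Subgroup.map_injective hψinj hqN
  rw [hmapD]
  exact Subgroup.mem_map_of_mem ψ (h111 (mem_normalizer_iff_conj_smul_eq.mpr hy))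

/-- **abc-iut-f-174's binder `h13ii′` ⟹ the normaliser form**: [Mzk8] = [GalSect] Thm 1.3 (ii) for cusps on `Π_{X_K}` («`D_x = C_{Π_{X_K}}(H)` for every
open subgroup `H ⊆ I_x`»), in the verbatim shape consumed by `TemperedDecompositionOfProfinite`, gives `N_{Π_{X_K}}(toHat I_{x₀}) ≤ toHat D_{x₀}`
(take `H := toHat I_{x₀} = toHat D_{x₀} ∩ Ker augHat`, f-174's `map_toHat_inertia`; it is closed — `I_{x₀} ≅ Ẑ(1)` compact — of index `1`;
normaliser `≤` commensurator). [cite: MochizukiGalSect2005, Thm 1.3 (ii) p.6] -/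
theorem normalizer_map_toHat_inertia_le_of_h13ii (hx₀ : M.IsCusp x₀)
    (h13ii' : ∀ x : M.Pt, M.IsCusp x → ∀ H : Subgroup M.PiHat,
      H ≤ (M.decomp x).map M.toHat.toMonoidHom ⊓ M.augHat.toMonoidHom.ker → IsClosed (H : Set M.PiHat) →
        (H.subgroupOf ((M.decomp x).map M.toHat.toMonoidHom ⊓ M.augHat.toMonoidHom.ker)).FiniteIndex →
          Subgroup.Commensurable.commensurator H = (M.decomp x).map M.toHat.toMonoidHom) :
    Subgroup.normalizer (((M.toTemperedCurve.inertia x₀).map M.toHat.toMonoidHom : Subgroup M.PiHat) : Set M.PiHat) ≤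
      (M.decomp x₀).map M.toHat.toMonoidHom := by
  have hI := M.toTemperedCurve.map_toHat_inertia x₀
  have hclosed : IsClosed (((M.toTemperedCurve.inertia x₀).map M.toHat.toMonoidHom : Subgroup M.PiHat) : Set M.PiHat) := by
    haveI := M.toTemperedCurve.compactSpace_inertia_of_isCusp hx₀
    haveI := M.isProfiniteCompletion_toHat.t2Space
    have hc : IsCompact ((M.toTemperedCurve.inertia x₀ : Subgroup M.PiTemp) : Set M.PiTemp) :=
      isCompact_iff_compactSpace.mpr inferInstance
    rw [Subgroup.coe_map]
    exact (hc.image M.toHat.continuous).isClosed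
  have hfi : (((M.toTemperedCurve.inertia x₀).map M.toHat.toMonoidHom).subgroupOf
      ((M.decomp x₀).map M.toHat.toMonoidHom ⊓ M.augHat.toMonoidHom.ker)).FiniteIndex := by
    rw [← hI, Subgroup.subgroupOf_self]
    infer_instance
  have hcomm := h13ii' x₀ hx₀ _ hI.le hclosed hfi
  exact (Anabelioids.normalizer_le_commensurator _).trans hcomm.le

end Transport

/-! ## 3. The row's results with the residual in the currency of [GalSect] Thm 1.3 (ii) on `Π_{X_K}` -/

section Results

variable {E : M.toThetaSetting.EtaleThetaData} {l : ℕ} (C : E.DoubleUnderline l) {N : ℕ+}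
  (μ : M.toThetaSetting.CyclotomeMod l N) (hC : M.toThetaSetting.Compat) (hS : M.toThetaSetting.Sec2Hyps)
  (hl : l.Prime) (hp2 : p ≠ 2) (hpl : p ≠ l) (hζ : ∃ ζ : M.toThetaSetting.K, IsPrimitiveRoot ζ (4 * l))
  {η : (C.thetaEnvData μ hC hS).PiYdd → MuN p N} (hη : η ∈ (C.thetaEnvData μ hC hS).thetaCocycles)
  (hZ : Thm16Sub.KerToZIsCompactlyGenerated M.toThetaSetting) (hN : (C.Huu.subgroupOf (M.GtpXu l)).Normal)
  {P : TopGroup.{0}} (T : TemperedCoverings (BadPlaceSetting.ofUnderline C μ hC hS hl hp2 hpl hζ hη) P) {x₀ : M.Pt}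

/-- **`|LabCusp^±(Π̂^±_v)| = l` at the tower of record, residual in the [GalSect] Thm 1.3 (ii) currency**: for every cuspidal datum with the
p432649 characterisation, modulo f-174's binder `h13ii′` (F-0103 instance form on `Π_{X_K}`), F-1674, `op`, «unique cusp», `hZ`, `hN`.
[claim: Mochizuki2012, status: disputed] (IUTchII §2 Def 2.3 (iii)/(v), kurims pp.68–69) -/
theorem card_labCuspPM_ofPiCHat_eq_l_of_h13ii (op : M.toThetaSetting.OncePuncturedData) (hx₀ : M.IsCusp x₀)
    (huniq : ∀ x' : M.Pt, M.IsCusp x' → x' = x₀) (h65iii : M.toTemperedCurve.IsoPreservesCuspidalDecomp M.toTemperedCurve)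
    (h13ii' : ∀ x : M.Pt, M.IsCusp x → ∀ H : Subgroup M.PiHat,
      H ≤ (M.decomp x).map M.toHat.toMonoidHom ⊓ M.augHat.toMonoidHom.ker → IsClosed (H : Set M.PiHat) →
        (H.subgroupOf ((M.decomp x).map M.toHat.toMonoidHom ⊓ M.augHat.toMonoidHom.ker)).FiniteIndex →
          Subgroup.Commensurable.commensurator H = (M.decomp x).map M.toHat.toMonoidHom)
    (CuHat : CuspidalInertiaData (ofPiCHat e C μ hC hS hl hp2 hpl hζ hη hZ hN T))
    (hCu : ∀ Q' J : Subgroup (ofPiCHat e C μ hC hS hl hp2 hpl hζ hη hZ hN T).Corhat,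
      CuHat.IsCuspidalInertia Q' J ↔ J ≤ Q' ∧ ∃ i : {x : M.Pt // M.IsCusp x} × M.GtpC,
        ∃ γ ∈ (ofPiCHat e C μ hC hS hl hp2 hpl hζ hη hZ hN T).pmHat,
          J = MulAut.conj γ •
            ((((MulAut.conj i.2 • (M.toTemperedCurve.inertia i.1.1).map M.inclX) ⊓ (M.GtpXu l).map M.inclX).map
              e.toPiCHat.toMonoidHom : Subgroup (ofPiCHat e C μ hC hS hl hp2 hpl hζ hη hZ hN T).Corhat)).topologicalClosure) :
    Nat.card (LabCuspPM CuHat (ofPiCHat e C μ hC hS hl hp2 hpl hζ hη hZ hN T).pmHat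
      (ofPiCHat e C μ hC hS hl hp2 hpl hζ hη hZ hN T).pmHat) = l :=
  card_labCuspPM_ofPiCHat_eq_l e C μ hC hS hl hp2 hpl hζ hη hZ hN T op hx₀ huniq h65iii
    (normalizer_inf_closure_le_of_hat e e.toPiCHat e.isProfiniteCompletion_toPiCHat
      (normalizer_map_toHat_inertia_le_of_h13ii hx₀ h13ii')) CuHat hCu

/-- **`Nonempty (FlTorsorStructureConj CuHat)` at the tower of record, residual in the [GalSect] Thm 1.3 (ii) currency**: the Def 2.3 (v)
successor structure EXISTS for every cuspidal datum with the p432649 characterisation, modulo f-174's binder `h13ii′` (F-0103 on `Π_{X_K}`),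
(R1c) `hR1c`, F-1674, `op`, «unique cusp», `hZ`, `hN`. [claim: Mochizuki2012, status: disputed] (IUTchII §2 Def 2.3 (v), kurims p.69) -/
theorem nonempty_flTorsorStructureConj_ofPiCHat_of_h13ii (op : M.toThetaSetting.OncePuncturedData) (hx₀ : M.IsCusp x₀)
    (huniq : ∀ x' : M.Pt, M.IsCusp x' → x' = x₀) (h65iii : M.toTemperedCurve.IsoPreservesCuspidalDecomp M.toTemperedCurve)
    (h13ii' : ∀ x : M.Pt, M.IsCusp x → ∀ H : Subgroup M.PiHat,
      H ≤ (M.decomp x).map M.toHat.toMonoidHom ⊓ M.augHat.toMonoidHom.ker → IsClosed (H : Set M.PiHat) →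
        (H.subgroupOf ((M.decomp x).map M.toHat.toMonoidHom ⊓ M.augHat.toMonoidHom.ker)).FiniteIndex →
          Subgroup.Commensurable.commensurator H = (M.decomp x).map M.toHat.toMonoidHom)
    (hR1c : ∀ w : M.PiTemp, M.toZ (e.conjX M.epsPM w) = (M.toZ w)⁻¹)
    (CuHat : CuspidalInertiaData (ofPiCHat e C μ hC hS hl hp2 hpl hζ hη hZ hN T))
    (hCu : ∀ Q' J : Subgroup (ofPiCHat e C μ hC hS hl hp2 hpl hζ hη hZ hN T).Corhat,
      CuHat.IsCuspidalInertia Q' J ↔ J ≤ Q' ∧ ∃ i : {x : M.Pt // M.IsCusp x} × M.GtpC,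
        ∃ γ ∈ (ofPiCHat e C μ hC hS hl hp2 hpl hζ hη hZ hN T).pmHat,
          J = MulAut.conj γ •
            ((((MulAut.conj i.2 • (M.toTemperedCurve.inertia i.1.1).map M.inclX) ⊓ (M.GtpXu l).map M.inclX).map
              e.toPiCHat.toMonoidHom : Subgroup (ofPiCHat e C μ hC hS hl hp2 hpl hζ hη hZ hN T).Corhat)).topologicalClosure) :
    Nonempty (FlTorsorStructureConj CuHat) :=
  nonempty_flTorsorStructureConj_ofPiCHat e C μ hC hS hl hp2 hpl hζ hη hZ hN T op hx₀ huniq h65iii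
    (normalizer_inf_closure_le_of_hat e e.toPiCHat e.isProfiniteCompletion_toPiCHat
      (normalizer_map_toHat_inertia_le_of_h13ii hx₀ h13ii')) hR1c CuHat hCu

end Results

end PlusMinusTower

end Literature.IUT.HodgeArakelov

end
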